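import Summits.QuantumFields.YangMills.Theorems.UnitScaleTiltProp7QSymEqTrueLinIter
import Summits.QuantumFields.YangMills.Theorems.UnitScaleTiltProp7SymAvgGLSmallOfRegPr
import Summits.QuantumFields.YangMills.Theorems.UnitScaleTiltProp7TowerStraightTransport
import Summits.QuantumFields.YangMills.Theorems.UnitScaleTiltProp8IterPlaqSmallAllL
import Summits.QuantumFields.YangMills.Theorems.UnitScaleTiltProp7HolRatioLinearResponse
import Summits.QuantumFields.YangMills.Theorems.UnitScaleTiltProp7AxialReprPrint
import Summits.QuantumFields.YangMills.Theorems.UnitScaleTiltProp7SPrintDefs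
import Literature.MathematicalPhysics.QuantumFieldTheory.Balaban1983to89.LatticeWordStokes
import Literature.MathematicalPhysics.QuantumFieldTheory.Balaban1983to89.T4TermwiseTorus
import Literature.MathematicalPhysics.QuantumLattice.BalabanRG
import HarnessLib

/-!
# `UnitScaleTiltProp7DescentStraightCloseness` — LANE II (B3c): THE ROUTE's COARSE TRANSPORTER `D̄_GL(W♭)(c)` IS `CT·e`-CLOSE TO THE STRAIGHT FINE TRANSPORT OF `W`
# BETWEEN THE BOX CORNERS, ON PRINT's REGULAR SPACE `RegPr F n K e W` (crux `MinimiserStabilityRegPr`, stmt-QuantumFields-19200, EX lane, hN06 LANE II, brick (B3c);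
# `--supports stmt-QuantumFields-19200 --as helper`, count-neutral)

Cell `ym3-torus` (HUMAN RULING D-0037: YM₃ on T³ is ladder rung R3 — NOT d = 4, NOT infinite volume, NOT a mass gap, NOT the Clay problem), width seat
`ym-ust-20520-w4` (g12).  THEOREMS ONLY (0 `def`, 0 `sorry`); registry ∕ skeleton texts untouched; nothing here claims (B3), (B2a), (REC), `hN06`, EX or the crux.

WHY.  ★p1 g19's (B2a) SIGNATURE-0 `exists_smoothRightInverse_QprimeCombL2` (lane II of `hN06`, OWNER RULING №23) is stated for every unitary coarse transporter
`T : PBond (F.P K) (K − n) → (M₂)ˣ` carrying the CLOSENESS RIDER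
`‖↑(T c) − ↑(holT (W♭) (x₀ + ℓ·c̃₋) [ℓ steps e_{c}])‖ ≤ CT·e` (`x₀ = basePt F n K`, `ℓ = L^{K−n}`, `c̃₋ = tlift c.src`), and w1 g15's (B3) fixes
`T c := descendToGL F n K hnK.le (bgUnits F K W) ((bondShift (sites_eq F n K hnK.le)).symm c)` (LANE II NAMER WORD №8 (B)(1)).  THIS FILE proves the rider for
that `T` — brick (B3c) — by name over landed theorems:

* ✓`Prop7QSymEqTrueLinIter.coe_descendToGL_bgUnits` — on the plaquette window `D̄_GL(W♭)(c) = Ū^{(K−n)}(ĉ)`, the `(K−n)`-fold symmetric (0.4) average of record;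
* ✓`IterPlaqSmallAllL.plaqSmall_iter_T3_allL` + lit ✓`LatticeWordStokes.dist1_loopHol_le` — every (0.4) loop variable of `Ū^{(s)}`, `s < K − n`, is within
  `a_s := (((d+2)L)²∕4)·(10800L+1)·e·L^{2s−2(K−n)}` of `1`; ✓`Prop7SymAvgGLSmallOfRegPr.guard_budget_T3` — `a_s < δ_{SU(2)}`;
* ✓`Prop7TowerStraightTransport.norm_iter_sub_straightIter_le` — the EML tower's bond variable at level `k` is the straight fine transporter
  `W([embIter k c₋ → Lᵏ steps e_c])` up to `θ_k` for ANY `θ` dominating `2a_s + L·θ_s ≤ θ_{s+1}`; here `θ := a` itself works (`(2 + L)·a_s ≤ L²·a_s = a_{s+1}`, `L ≥ 2`),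
  so `θ_{K−n} = a_{K−n} = (((d+2)L)²∕4)·(10800L+1)·e` — `k`-UNIFORM, `L`-only constant (c2-legal);
* ✓`Prop7AxialReprPrint.embIter_eq_transl` — `embIter k c₋ = x₀ + Lᵏ·c̃₋`, i.e. the SIGNATURE-0's corner `transl (basePt F n K) (blockBase ℓ (tlift c.src))`;
* ✓`Prop7HolRatioLinearResponse.coe_holT_eq_coe_holAt` — `↑(holT (W♭) x w) = ↑(holAt W (walk x w))` (`W♭ = unitsField (toUField W)` bondwise `= W`, `rfl`).

WHAT IS PROVED (ns `…Theorems.Prop7DescentStraightCloseness`).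
* §1 `loopSize_le_of_regPr` — the quantitative loop sizes of the tower on `RegPr`; `loopSize_step` — `(2 + L)·a_s ≤ a_{s+1}`.
* §2 ★★ `norm_iter_sub_straight_le_of_regPr` — `‖↑(Ū^{(K−n)}(c)) − ↑(W([embIter (K−n) c₋ → ℓ steps e_c]))‖ ≤ (((d+2)L)²∕4)·(10800L+1)·e` on `RegPr F n K e W`, `10⁷L³e ≤ 1`.
* §3 ★★★ `descent_straight_closeness` — (B3c) in the SIGNATURE-0's letters: `∀ L, 1 < L → ∃ CT e3, 0 ≤ CT ∧ 0 < e3 ∧ ∀ F (F.L = L) n K (hnK : n < K) e W, 0 < e → e ≤ e3 →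
  RegPr F n K e W → ∀ c, ‖↑(T c) − ↑(holT (W♭) (transl x₀ (blockBase ℓ (tlift c.src))) (replicate ℓ (c.dir, true)))‖ ≤ CT·e` with `CT := (25L²∕4)·(10800L+1)`,
  `e3 := (10⁷L³)⁻¹`.

HONEST SCOPE.  A composition of landed theorems + arithmetic; no new estimate.  The constant is the EML tower's (`O(L³)`, from the crude `(2+L) ≤ L²` domination),
not print's area constant `256(d+1)(d+4)α₀` of lit ✓`B7Eq47AveragedBondVsStraight` (that is the COMB average (43), not the route's symmetric (0.4) average) — (B2a)
only asks for SOME `L`-only `CT`.  Rung R3; nothing of the crux ∕ the gap is claimed.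

References: T. Bałaban, CMP 109 (1987) 249–301 [Balaban1987RG1] ((0.1) p.251, (0.4)+(0.11) p.253); CMP 102 (1985) 277–309 [Balaban1985Variational] ((2), (6) p.278,
(146) p.301); CMP 98 (1985) 17–51 [Balaban1985Averaging] ((9) p.18, (42)–(47) pp.23–25).
-/

set_option autoImplicit false

noncomputable section

open scoped BigOperators Matrix.Norms.L2Operator

namespace Summit.QuantumFields.YangMills.Theorems.Prop7DescentStraightCloseness

open Literature.MathematicalPhysics.QuantumFieldTheory.Balaban1983to89
open Literature.MathematicalPhysics.QuantumFieldTheory.Balaban1983to89.T3ContinuumYM3Torus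
open Literature.MathematicalPhysics.QuantumLattice (blockBase)
open T4Continuum BlockAveraging AveragingRT ExpMeanLog
open T3PrintedRegularMinimiser (RegPr)
open T3RegularMinimiser (regThreshold)
open T3LevelShift (siteShift bondShift)
open T3PrintedRegularOrbits (sites_eq)
open T3SectALandauChart (bgUnits)
open B10Eq27TorusAxialLog (transl holT unitsField toUField transl_apply)
open B15DeterminingSets (embIter)
open T4TermwiseTorus (tlift)
open LatticeWordStokes (dist1_loopHol_le)
open Summit.QuantumFields.YangMills.Theorems.Prop7SymAvgGL (descendToGL)
open Summit.QuantumFields.YangMills.Theorems.Prop7SPrint (basePt)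
open Summit.QuantumFields.YangMills.Theorems.Prop7QSymEqTrueLinIter (coe_descendToGL_bgUnits)
open Summit.QuantumFields.YangMills.Theorems.Prop7SymAvgGLSmallOfRegPr (guard_budget_T3)
open Summit.QuantumFields.YangMills.Theorems.IterPlaqSmallAllL (plaqSmall_iter_T3_allL)
open Summit.QuantumFields.YangMills.Theorems.Prop7TowerStraightTransport (norm_iter_sub_straightIter_le)
open Summit.QuantumFields.YangMills.Theorems.Prop7HolRatioLinearResponse (coe_holT_eq_coe_holAt)
open Summit.QuantumFields.YangMills.Theorems.Prop7AxialReprPrint (embIter_eq_transl)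

variable (F : T3Family) (n K : ℕ)

/-! ## §1 The quantitative loop sizes of the symmetric tower on `RegPr` -/

/-- **LOOP SIZES OF THE TOWER ON THE PLAQUETTE WINDOW**: for `10⁷L³e ≤ 1`, `PlaqSmall (regThreshold F n K e) W`, every `s ≤ K − n`, coarse bond `c` of level `s + 1` and loop
index `i`, `dist1 (Ū^{(s)}(loop_i(c))) ≤ (((d+2)L)²∕4)·((10800L+1)·(L^{2s}·(e·L^{−2(K−n)})))` (multi-level plaquette smallness ∘ lattice Stokes on the closed (0.4) loop words).
[cite: Balaban1985Variational, (146) p.301; Balaban1987RG1, (0.4) p.253] -/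
theorem loopSize_le_of_plaqSmall {e : ℝ} (he : 0 < e) (hε : 10 ^ 7 * (F.L : ℝ) ^ 3 * e ≤ 1)
    (W : GaugeField (F.P K) 0 (Matrix.specialUnitaryGroup (Fin 2) ℂ)) (hW : PlaqSmall (regThreshold F n K e) W) :
    ∀ s, s ≤ K - n → ∀ (c : PBond (F.P K) (s + 1)) (i : Idx (F.P K)),
      dist1 (loopHol (Averaging.iter (fun l => blockAvg (P := F.P K) (j := l) (expMeanLogSU (n := Fin 2))) s W) c i)
        ≤ ((((F.P K).d + 2) * (F.P K).L : ℕ) : ℝ) ^ 2 / 4 * ((10800 * (F.L : ℝ) + 1) * ((F.L : ℝ) ^ (2 * s) * regThreshold F n K e)) := by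
  intro s hs c i
  have hpl := plaqSmall_iter_T3_allL F n K he hε W hW s hs
  have ht0 : 0 ≤ (10800 * (F.L : ℝ) + 1) * ((F.L : ℝ) ^ (2 * s) * regThreshold F n K e) := by
    unfold regThreshold; positivity
  exact dist1_loopHol_le ht0 hpl c i

/-- **THE DOMINATION STEP**: the loop-size profile `a_s := A·L^{2s}·r` satisfies `2·a_s + L·a_s ≤ a_{s+1}` for `L ≥ 2` (`(2 + L) ≤ L²`), so it dominates ITS OWN tower
recursion `2a_s + Lθ_s ≤ θ_{s+1}` of ✓`norm_iter_sub_straightIter_le`. [cite: Balaban1987RG1, (0.4)+(0.11) p.253] -/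
theorem loopSize_step {A L r : ℝ} (hA : 0 ≤ A) (hr : 0 ≤ r) (hL : 2 ≤ L) (s : ℕ) :
    2 * (A * (L ^ (2 * s) * r)) + L * (A * (L ^ (2 * s) * r)) ≤ A * (L ^ (2 * (s + 1)) * r) := by
  have hpow : L ^ (2 * (s + 1)) = L ^ 2 * L ^ (2 * s) := by
    rw [show 2 * (s + 1) = 2 + 2 * s by ring, pow_add]
  rw [hpow]
  have h0 : 0 ≤ A * (L ^ (2 * s) * r) := by
    have : 0 ≤ L := by linarith
    positivity
  have hL2 : 2 + L ≤ L ^ 2 := by nlinarith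
  nlinarith [mul_le_mul_of_nonneg_right hL2 h0]

/-! ## §2 ★★ The tower's top bond variable versus the straight fine transporter, on `RegPr` -/

/-- ★★ **`‖↑(Ū^{(K−n)}(c)) − ↑(W([embIter (K−n) c₋ → L^{K−n} steps e_c]))‖ ≤ (((d+2)L)²∕4)·(10800L+1)·e` ON THE PLAQUETTE WINDOW** (`10⁷L³e ≤ 1`): the symmetric (0.4)
tower's level-`(K−n)` bond variable is the straight fine transporter of the ORIGINAL field up to an `L`-only multiple of `e`, uniformly in `K − n` — ✓`norm_iter_sub_straightIter_le`
with `a = θ :=` §1's profile (`a_s ≤ a_{K−n} ≤ 1∕50 < min (1∕6) δ_{SU(2)}` by ✓`guard_budget_T3`'s arithmetic). [cite: Balaban1987RG1, (0.4)+(0.11) p.253; Balaban1985Variational, (146) p.301] -/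
theorem norm_iter_sub_straight_le_of_plaqSmall {e : ℝ} (he : 0 < e) (hε : 10 ^ 7 * (F.L : ℝ) ^ 3 * e ≤ 1)
    (W : GaugeField (F.P K) 0 (Matrix.specialUnitaryGroup (Fin 2) ℂ)) (hW : PlaqSmall (regThreshold F n K e) W) (c : PBond (F.P K) (K - n)) :
    ‖((Averaging.iter (fun l => blockAvg (P := F.P K) (j := l) (expMeanLogSU (n := Fin 2))) (K - n) W c : Matrix.specialUnitaryGroup (Fin 2) ℂ) :
          Matrix (Fin 2) (Fin 2) ℂ)
        - ((holAt W (walk (embIter (K - n) c.src) (List.replicate ((F.P K).L ^ (K - n)) (c.dir, true))) : Matrix.specialUnitaryGroup (Fin 2) ℂ) :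
          Matrix (Fin 2) (Fin 2) ℂ)‖
      ≤ ((((F.P K).d + 2) * (F.P K).L : ℕ) : ℝ) ^ 2 / 4 * ((10800 * (F.L : ℝ) + 1) * e) := by
  have hd : (F.P K).d = 3 := T3Family.P_d F K
  have hLL : ((F.P K).L : ℝ) = F.L := rfl
  have hL3 : 3 ≤ F.L := by obtain ⟨a, ha⟩ := F.hL.1; have := F.hL.2; omega
  have hL3r : (3 : ℝ) ≤ F.L := by exact_mod_cast hL3
  have hL0 : (0 : ℝ) < F.L := by linarith
  -- the loop-size profile
  set A : ℝ := ((((F.P K).d + 2) * (F.P K).L : ℕ) : ℝ) ^ 2 / 4 * (10800 * (F.L : ℝ) + 1) with hA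
  have hA0 : 0 ≤ A := by rw [hA]; positivity
  set a : ℕ → ℝ := fun s => A * ((F.L : ℝ) ^ (2 * s) * regThreshold F n K e) with ha
  have hreg0 : 0 ≤ regThreshold F n K e := by unfold regThreshold; positivity
  have ha_eq : ∀ s, a s = ((((F.P K).d + 2) * (F.P K).L : ℕ) : ℝ) ^ 2 / 4 * ((10800 * (F.L : ℝ) + 1) * ((F.L : ℝ) ^ (2 * s) * regThreshold F n K e)) := by
    intro s; simp only [ha, hA]; ring
  -- `a (K − n) = A·e`
  have hatop : a (K - n) = A * e := by
    simp only [ha]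
    unfold regThreshold
    have hne : (F.L : ℝ) ^ (2 * (K - n)) ≠ 0 := pow_ne_zero _ hL0.ne'
    rw [inv_pow, ← mul_assoc ((F.L : ℝ) ^ (2 * (K - n))), mul_comm ((F.L : ℝ) ^ (2 * (K - n))) e, mul_assoc e, mul_inv_cancel₀ hne, mul_one]
  -- `a s ≤ a (K − n) ≤ 1∕50`
  have hamono : ∀ s, s ≤ K - n → a s ≤ A * e := by
    intro s hs
    rw [← hatop]
    simp only [ha]
    refine mul_le_mul_of_nonneg_left (mul_le_mul_of_nonneg_right ?_ hreg0) hA0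
    exact pow_le_pow_right₀ (by linarith) (by omega)
  have hAe : A * e ≤ 1 / 50 := by
    rw [hA, hd]
    push_cast
    rw [hLL]
    have h2 : (F.L : ℝ) ^ 2 * e ≤ (F.L : ℝ) ^ 3 * e :=
      mul_le_mul_of_nonneg_right (pow_le_pow_right₀ (by linarith) (by norm_num)) he.le
    nlinarith [h2, sq_nonneg (F.L : ℝ), he.le]
  have hmain := norm_iter_sub_straightIter_le (P := F.P K) (n := Fin 2) W a a (by rw [ha_eq]; positivity)
    (fun s => by
      simp only [ha]
      rw [hLL]
      exact loopSize_step hA0 hreg0 (by linarith) s)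
    (K - n)
    (fun s hs c' i => by rw [ha_eq]; exact loopSize_le_of_plaqSmall F n K he hε W hW s hs.le c' i)
    (fun s hs => by linarith [hamono s hs.le])
    (fun s hs => by rw [ha_eq]; exact guard_budget_T3 F n K he hε hs.le)
    c
  calc _ ≤ a (K - n) := hmain
    _ = A * e := hatop
    _ = _ := by rw [hA]; ring

/-- ★★ The same on print's regular space `RegPr F n K e W` (only its plaquette clause is used). [cite: Balaban1985Variational, (2), (6) p.278, (146) p.301; Balaban1987RG1, (0.4) p.253] -/
theorem norm_iter_sub_straight_le_of_regPr {e : ℝ} (he : 0 < e) (hε : 10 ^ 7 * (F.L : ℝ) ^ 3 * e ≤ 1)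
    {W : GaugeField (F.P K) 0 (Matrix.specialUnitaryGroup (Fin 2) ℂ)} (hreg : RegPr F n K e W) (c : PBond (F.P K) (K - n)) :
    ‖((Averaging.iter (fun l => blockAvg (P := F.P K) (j := l) (expMeanLogSU (n := Fin 2))) (K - n) W c : Matrix.specialUnitaryGroup (Fin 2) ℂ) :
          Matrix (Fin 2) (Fin 2) ℂ)
        - ((holAt W (walk (embIter (K - n) c.src) (List.replicate ((F.P K).L ^ (K - n)) (c.dir, true))) : Matrix.specialUnitaryGroup (Fin 2) ℂ) :
          Matrix (Fin 2) (Fin 2) ℂ)‖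
      ≤ ((((F.P K).d + 2) * (F.P K).L : ℕ) : ℝ) ^ 2 / 4 * ((10800 * (F.L : ℝ) + 1) * e) :=
  norm_iter_sub_straight_le_of_plaqSmall F n K he hε W hreg.plaqSmall c

/-! ## §3 ★★★ (B3c): the route's coarse transporter versus the straight transport between the box corners -/

/-- **THE BOX CORNER IS THE `k`-CENTRE**: `transl (basePt F n K) (blockBase (L^{K−n}) (tlift y)) = embIter (K − n) y` (✓`embIter_eq_transl` with the casts spelled out).
[cite: Balaban1987RG1, (0.1) p.251] -/
theorem transl_basePt_blockBase_tlift (hnK : n ≤ K) (y : Site (F.P K) (K - n)) :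
    transl (basePt F n K) (blockBase ((F.P K).L ^ (K - n)) (tlift y)) = embIter (K - n) y := by
  have hk : K - n ≤ (F.P K).m + (F.P K).K := by
    show K - n ≤ F.m + K; omega
  rw [embIter_eq_transl hk y]
  show transl (embIter (K - n) (0 : Site (F.P K) (K - n))) _ = _
  congr 1

/-- ★★★ **(B3c) — THE CLOSENESS RIDER OF (B2a) FOR w1 g15's `T := descendToGL F n K hnK.le (bgUnits F K W) ((bondShift (sites_eq F n K hnK.le)).symm c)`**: for every `L > 1` there are
`CT := (25L²∕4)·(10800L+1) ≥ 0` and `e3 := (10⁷L³)⁻¹ > 0` such that for every family with `F.L = L`, `n < K`, `0 < e ≤ e3`, `RegPr F n K e W` and every coarse bond `c` of level `K − n`,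
`‖↑(T c) − ↑(holT (unitsField (toUField W)) (transl (basePt F n K) (blockBase (L^{K−n}) (tlift c.src))) (List.replicate (L^{K−n}) (c.dir, true)))‖ ≤ CT·e` — the binder text of ★p1 g19's
SIGNATURE-0 `exists_smoothRightInverse_QprimeCombL2` VERBATIM at that `T`.  Proof: §2 ∘ ✓`coe_descendToGL_bgUnits` ∘ ✓`coe_holT_eq_coe_holAt` ∘ `transl_basePt_blockBase_tlift`.
[cite: Balaban1987RG1, (0.1) p.251, (0.4)+(0.11) p.253; Balaban1985Variational, (6) p.278, (146) p.301; Balaban1985Averaging, (9) p.18] -/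
theorem descent_straight_closeness :
    ∀ (L : ℕ), 1 < L → ∃ CT e3 : ℝ, 0 ≤ CT ∧ 0 < e3 ∧
      ∀ (F : T3Family), F.L = L → ∀ (n K : ℕ) (hnK : n < K) (e : ℝ), 0 < e → e ≤ e3 →
        ∀ (W : GaugeField (F.P K) 0 (Matrix.specialUnitaryGroup (Fin 2) ℂ)), RegPr F n K e W →
          ∀ c : PBond (F.P K) (K - n),
            ‖((descendToGL F n K hnK.le (bgUnits F K W) ((bondShift (sites_eq F n K hnK.le)).symm c) : (Matrix (Fin 2) (Fin 2) ℂ)ˣ) : Matrix (Fin 2) (Fin 2) ℂ)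
                - ((holT (unitsField (toUField W)) (transl (basePt F n K) (blockBase ((F.P K).L ^ (K - n)) (tlift c.src)))
                    (List.replicate ((F.P K).L ^ (K - n)) (c.dir, true)) : (Matrix (Fin 2) (Fin 2) ℂ)ˣ) : Matrix (Fin 2) (Fin 2) ℂ)‖
              ≤ CT * e := by
  intro L hL
  refine ⟨(5 * (L : ℝ)) ^ 2 / 4 * (10800 * (L : ℝ) + 1), (10 ^ 7 * (L : ℝ) ^ 3)⁻¹, by positivity, by positivity, ?_⟩
  intro F hF n K hnK e he he3 W hreg c
  have hd : (F.P K).d = 3 := T3Family.P_d F K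
  have hLL : ((F.P K).L : ℝ) = F.L := rfl
  have hL0 : (0 : ℝ) < (L : ℝ) := by exact_mod_cast (lt_trans Nat.zero_lt_one hL)
  -- the window `10⁷L³e ≤ 1`
  have hε : 10 ^ 7 * (F.L : ℝ) ^ 3 * e ≤ 1 := by
    rw [hF]
    have hpos : (0 : ℝ) < 10 ^ 7 * (L : ℝ) ^ 3 := by positivity
    calc 10 ^ 7 * (L : ℝ) ^ 3 * e ≤ 10 ^ 7 * (L : ℝ) ^ 3 * (10 ^ 7 * (L : ℝ) ^ 3)⁻¹ := mul_le_mul_of_nonneg_left he3 hpos.le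
      _ = 1 := mul_inv_cancel₀ hpos.ne'
  -- (1) the descent IS the tower's top bond variable at `ĉ = c`
  have h1 : ((descendToGL F n K hnK.le (bgUnits F K W) ((bondShift (sites_eq F n K hnK.le)).symm c) : (Matrix (Fin 2) (Fin 2) ℂ)ˣ) :
        Matrix (Fin 2) (Fin 2) ℂ)
      = ((Averaging.iter (fun l => blockAvg (P := F.P K) (j := l) (expMeanLogSU (n := Fin 2))) (K - n) W c : Matrix.specialUnitaryGroup (Fin 2) ℂ) :
          Matrix (Fin 2) (Fin 2) ℂ) := by
    rw [coe_descendToGL_bgUnits F hnK.le he hε W hreg.plaqSmall, Equiv.apply_symm_apply]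
  -- (2) the units holonomy IS the special-unitary holonomy, from the `k`-centre
  have h2 : ((holT (unitsField (toUField W)) (transl (basePt F n K) (blockBase ((F.P K).L ^ (K - n)) (tlift c.src)))
        (List.replicate ((F.P K).L ^ (K - n)) (c.dir, true)) : (Matrix (Fin 2) (Fin 2) ℂ)ˣ) : Matrix (Fin 2) (Fin 2) ℂ)
      = ((holAt W (walk (embIter (K - n) c.src) (List.replicate ((F.P K).L ^ (K - n)) (c.dir, true))) : Matrix.specialUnitaryGroup (Fin 2) ℂ) :
          Matrix (Fin 2) (Fin 2) ℂ) := by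
    rw [transl_basePt_blockBase_tlift F n K hnK.le]
    exact coe_holT_eq_coe_holAt (E := ℂ) W (fun _ : ℂ => unitsField (toUField W)) (a := 0) (fun _ => rfl) _ _
  rw [h1, h2]
  refine (norm_iter_sub_straight_le_of_regPr F n K he hε hreg c).trans (le_of_eq ?_)
  rw [hd]
  push_cast
  rw [hLL, hF]
  ring

end Summit.QuantumFields.YangMills.Theorems.Prop7DescentStraightCloseness

end
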